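import Mathlib.NumberTheory.NumberField.Basic
import Summits.BirchSwinnertonDyer.BirchSwinnertonDyer.Theorems.Rank2Observatory2DescZ2SplitOdd
import Summits.BirchSwinnertonDyer.BirchSwinnertonDyer.Theorems.Rank2Observatory2DescZ2SplitTwo
import HarnessLib

/-!
# BirchSwinnertonDyer — rank ≥ 2 observatory: integral form of a rational point and class transport (ℤ/2-torsion rows)

HONEST FRAMING: per-curve certified theorems and census instruments; no claim on BSD in rank ≥ 2.

Generic piece of the successor instrument KERNEL-2DESC-Z2 (spec
`code/b2b-bsdr2-cert-3/kernel-2desc-z2/README-Z2.md`, § "How the Lean casework should be organised",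
step 5 "soundness chain"). Two elementary bridges between the cover theorem
(`…Z2RankBound.mordellWeilRank_le_of_coverSet_z2`, whose admissibility hypothesis speaks of a rational
point `(x, y)` and a square `(x − θ)·w ∈ K²`) and the residue casework (`…Z2OddCase`, `…Z2TwoCase`,
which speaks of `α = n − eθ ∈ 𝓞 K` with `e = d₀²`, `gcd(n, d₀) = 1`, `m² = n(n² + Ane + Be²)`):

* `exists_integral_form` — a rational point of `y² = x³ + Ax² + Bx` has `x = n/d₀²` with
  `gcd(n, d₀) = 1`, `d₀ ≠ 0` and `n(n² + A n d₀² + B d₀⁴)` a perfect square (the denominator of `x`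
  is a square: `b·a(a² + Aab + Bb²) = (yb²)²` with the two factors coprime, `Int.sq_of_isCoprime`);
* `exists_sq_of_isSquare_point` — `(x − θ)·w ∈ K²` with `x = n/e` gives `γ ∈ 𝓞 K` with
  `(n − eθ)·(w·e) = γ²` (integral closedness), whence `bitsAt d (n − eθ) = bitsAt d w` at every split
  odd prime and `bitsAt₂ d (n − eθ) = bitsAt₂ d w` at the primes over `2` (`e = d₀²` is a square).

Sorry-free; axioms `propext`, `Classical.choice`, `Quot.sound`.
[cite: Cassels1991LecturesEllipticCurves, §15] [cite: SilvermanAEC2009, Prop. X.1.4]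
-/

-- single-conjunct summit: `Summit.BirchSwinnertonDyer.BirchSwinnertonDyer.…` repeats the name by design
set_option linter.dupNamespace false

noncomputable section

open scoped NumberField

namespace Summit.BirchSwinnertonDyer.BirchSwinnertonDyer.Rank2Observatory.TwoDescZ2

/-! ## Integral form of a rational point -/

/-- **Integral form.** A rational point `(x, y)` of `y² = x³ + Ax² + Bx` has `x = n / d₀²` with
`gcd(n, d₀) = 1`, `d₀ ≠ 0`, and `n(n² + A n d₀² + B d₀⁴) = m²`. [cite: SilvermanAEC2009, Prop. X.1.4] -/
theorem exists_integral_form {A B : ℤ} {x y : ℚ} (h : y ^ 2 = x ^ 3 + A * x ^ 2 + B * x) :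
    ∃ n d₀ m : ℤ, d₀ ≠ 0 ∧ IsCoprime n d₀ ∧ x = (n : ℚ) / ((d₀ : ℚ) ^ 2) ∧
      m ^ 2 = n * (n ^ 2 + A * n * d₀ ^ 2 + B * (d₀ ^ 2) ^ 2) := by
  set a : ℤ := x.num with ha
  set b : ℤ := (x.den : ℤ) with hb
  have hb0 : (0 : ℤ) < b := by rw [hb]; exact_mod_cast x.den_pos
  have hbQ : (b : ℚ) ≠ 0 := by exact_mod_cast hb0.ne'
  have hx : x = (a : ℚ) / (b : ℚ) := by rw [ha, hb, Int.cast_natCast, Rat.num_div_den]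
  have hcop : IsCoprime a b := by
    rw [Int.isCoprime_iff_gcd_eq_one, Int.gcd, hb, Int.natAbs_natCast]
    exact x.reduced
  set M : ℤ := a * (a ^ 2 + A * a * b + B * b ^ 2) with hM
  -- `b · M = (y b²)²`
  have hsqQ : ((b * M : ℤ) : ℚ) = (y * (b : ℚ) ^ 2) ^ 2 := by
    rw [hM, mul_pow, h, hx]
    push_cast
    field_simp
  have hsqZ : IsSquare (b * M) := by
    rw [← Rat.isSquare_intCast_iff]
    exact ⟨y * (b : ℚ) ^ 2, by rw [hsqQ, sq]⟩
  obtain ⟨c, hc⟩ := hsqZ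
  have hc' : b * M = c ^ 2 := by rw [hc, sq]
  -- `gcd(b, M) = 1`
  have hbM : IsCoprime b M := by
    rw [hM]
    refine IsCoprime.mul_right hcop.symm ?_
    have h1 : IsCoprime b (a ^ 2) := hcop.symm.pow_right
    have h2 : a ^ 2 + A * a * b + B * b ^ 2 = a ^ 2 + b * (A * a + B * b) := by ring
    rw [h2]
    exact h1.add_mul_left_right _
  -- so `b = d₀²`
  obtain ⟨d₀, hd₀⟩ : ∃ d₀ : ℤ, b = d₀ ^ 2 := by
    obtain ⟨d, hd | hd⟩ := Int.sq_of_isCoprime hbM hc'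
    · exact ⟨d, hd⟩
    · exfalso; nlinarith [sq_nonneg d]
  -- and `M = m²`
  obtain ⟨m, hm⟩ : ∃ m : ℤ, M = m ^ 2 := by
    obtain ⟨d, hd | hd⟩ := Int.sq_of_isCoprime hbM.symm (by rw [mul_comm]; exact hc')
    · exact ⟨d, hd⟩
    · refine ⟨0, ?_⟩
      have hM0 : 0 ≤ M := by
        by_contra hneg
        push Not at hneg
        have : b * M < 0 := mul_neg_of_pos_of_neg hb0 hneg
        nlinarith [sq_nonneg c]
      nlinarith [sq_nonneg d]
  have hd₀0 : d₀ ≠ 0 := by rintro rfl; simp at hd₀; omega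
  refine ⟨a, d₀, m, hd₀0, ?_, ?_, ?_⟩
  · exact (IsCoprime.pow_right_iff two_pos).mp (hd₀ ▸ hcop)
  · rw [hx, hd₀]; push_cast; rfl
  · rw [← hm, hM, hd₀]

/-- A coprimality corollary in the shape the casework wants. [folklore] -/
theorem not_dvd_and_dvd_of_isCoprime {n d₀ : ℤ} (h : IsCoprime n d₀) {p : ℤ} (hp : ¬ IsUnit p) :
    ¬ (p ∣ n ∧ p ∣ d₀) := fun ⟨h1, h2⟩ => hp (h.isUnit_of_dvd' h1 h2)

/-! ## Clearing denominators in `K` -/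

variable {K : Type*} [Field K] [NumberField K]

/-- **Square relation in `𝓞 K`.** If `(x − θ)·w ∈ K²` with `x = n/e` (`θ, w ∈ 𝓞 K`), then
`(n − eθ)·(w·e) = γ²` for some `γ ∈ 𝓞 K`. [cite: Cassels1991LecturesEllipticCurves, §15] -/
theorem exists_sq_of_isSquare_point {θ w : 𝓞 K} {x : ℚ} {n e : ℤ} (he : (e : ℚ) ≠ 0)
    (hx : x = (n : ℚ) / (e : ℚ))
    (h : IsSquare ((algebraMap ℚ K x - algebraMap (𝓞 K) K θ) * algebraMap (𝓞 K) K w)) :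
    ∃ γ : 𝓞 K, ((n : 𝓞 K) - (e : 𝓞 K) * θ) * (w * (e : 𝓞 K)) = γ ^ 2 := by
  obtain ⟨z, hz⟩ := h
  set ζ : K := algebraMap ℚ K (e : ℚ) * z with hζ
  have hex : algebraMap ℚ K (e : ℚ) * algebraMap ℚ K x = algebraMap ℚ K (n : ℚ) := by
    rw [← map_mul, hx, mul_div_cancel₀ _ he]
  have hζ2 : ζ ^ 2 = algebraMap (𝓞 K) K (((n : 𝓞 K) - (e : 𝓞 K) * θ) * (w * (e : 𝓞 K))) := by
    have hz' : (algebraMap ℚ K x - algebraMap (𝓞 K) K θ) * algebraMap (𝓞 K) K w = z ^ 2 := by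
      rw [hz, sq]
    simp only [map_mul, map_sub, map_intCast]
    simp only [map_intCast] at hex
    rw [hζ, mul_pow, ← hz', map_intCast]
    linear_combination ((e : K) * algebraMap (𝓞 K) K w) * hex
  have hint : IsIntegral ℤ ζ := by
    refine IsIntegral.of_pow two_pos ?_
    rw [hζ2]
    exact (((n : 𝓞 K) - (e : 𝓞 K) * θ) * (w * (e : 𝓞 K))).isIntegral_coe
  obtain ⟨γ, hγ⟩ := (IsIntegralClosure.isIntegral_iff (A := 𝓞 K)).mp hint
  refine ⟨γ, ?_⟩
  apply NumberField.RingOfIntegers.coe_injective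
  rw [map_pow, hγ, hζ2]

variable {ℓ : ℕ} [Fact ℓ.Prime]

/-- **Class transport at a split odd prime**: `(x − θ)·w ∈ K²`, `x = n/d₀²` ⇒
`bitsAt d (n − d₀²θ) = bitsAt d w`. [cite: Cassels1991LecturesEllipticCurves, §15] -/
theorem bitsAt_point_eq_of_isSquare (d : SplitPrime (𝓞 K) ℓ) {θ w : 𝓞 K} {x : ℚ} {n e d₀ : ℤ}
    (he : e = d₀ ^ 2) (hd₀ : d₀ ≠ 0) (hx : x = (n : ℚ) / (e : ℚ))
    (hα : (n : 𝓞 K) - (e : 𝓞 K) * θ ≠ 0) (hw : w ≠ 0)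
    (h : IsSquare ((algebraMap ℚ K x - algebraMap (𝓞 K) K θ) * algebraMap (𝓞 K) K w)) :
    bitsAt d ((n : 𝓞 K) - (e : 𝓞 K) * θ) = bitsAt d w := by
  have heQ : (e : ℚ) ≠ 0 := by rw [he]; exact_mod_cast pow_ne_zero 2 hd₀
  have heR : (e : 𝓞 K) ≠ 0 := by rw [he]; exact_mod_cast pow_ne_zero 2 hd₀
  obtain ⟨γ, hγ⟩ := exists_sq_of_isSquare_point heQ hx h
  have hd₀R : ((d₀ : 𝓞 K)) ≠ 0 := by exact_mod_cast hd₀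
  rw [bitsAt_eq_of_mul_eq_sq hα (mul_ne_zero hw heR) hγ, bitsAt_mul hw heR,
    show ((e : 𝓞 K)) = (d₀ : 𝓞 K) ^ 2 by rw [he]; push_cast; ring, bitsAt_sq hd₀R, add_zero]

/-- **Class transport at the primes over `2`**: `(x − θ)·w ∈ K²`, `x = n/d₀²` ⇒
`bitsAt₂ d (n − d₀²θ) = bitsAt₂ d w`. [cite: Cassels1991LecturesEllipticCurves, §15] -/
theorem bitsAt₂_point_eq_of_isSquare (d : SplitTwo (𝓞 K)) {θ w : 𝓞 K} {x : ℚ} {n e d₀ : ℤ}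
    (he : e = d₀ ^ 2) (hd₀ : d₀ ≠ 0) (hx : x = (n : ℚ) / (e : ℚ))
    (hα : (n : 𝓞 K) - (e : 𝓞 K) * θ ≠ 0) (hw : w ≠ 0)
    (h : IsSquare ((algebraMap ℚ K x - algebraMap (𝓞 K) K θ) * algebraMap (𝓞 K) K w)) :
    bitsAt₂ d ((n : 𝓞 K) - (e : 𝓞 K) * θ) = bitsAt₂ d w := by
  have heQ : (e : ℚ) ≠ 0 := by rw [he]; exact_mod_cast pow_ne_zero 2 hd₀
  have heR : (e : 𝓞 K) ≠ 0 := by rw [he]; exact_mod_cast pow_ne_zero 2 hd₀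
  obtain ⟨γ, hγ⟩ := exists_sq_of_isSquare_point heQ hx h
  have hd₀R : ((d₀ : 𝓞 K)) ≠ 0 := by exact_mod_cast hd₀
  rw [bitsAt₂_eq_of_mul_eq_sq hα (mul_ne_zero hw heR) hγ, bitsAt₂_mul hw heR,
    show ((e : 𝓞 K)) = (d₀ : 𝓞 K) ^ 2 by rw [he]; push_cast; ring, bitsAt₂_sq hd₀R, add_zero]

end Summit.BirchSwinnertonDyer.BirchSwinnertonDyer.Rank2Observatory.TwoDescZ2

end
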